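import Summits.Ventures.PercRepro.ProfilePointedCircuitClassesStarNineDefectC
import Summits.Ventures.PercRepro.ProfilePointedCircuitClassesStarNineReduce

/-!
# PercRepro — `StarNine` FROM THE DEFECT BOUND ON THE SIMPLE COSIMPLE CORE
(p5, gen 57; `proofs/P5-GM1.md` §85 ADD 2(c))

`starNine_of_coreDefectBound`: if on every simple cosimple matroid with `#E = 9`, `ρ(E) = 5` and every `e ≠ f` the
defect bound `|D_e| ≤ |D_f| + |C|` holds, then `StarNine α` — the non-core is `starNine_of_not_simple_cosimple`, the core
is the bound through `starNine_of_defect_bound`.  The two structural reductions: a matroid without loop and without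
parallel pair is simple (`rk_pair_of_no_loop_no_parallel`), a coloop-free matroid without series pair is cosimple
(`rk_erase_erase_of_no_seriesPair`).
-/

open scoped Matroid

namespace PercRepro.Cogirth

open Finset ThmH Skew Shadow Profile

open Classical

variable {α : Type} [DecidableEq α] {N : Matroid α} [N.Finite]

section StarNineDefectD

/-- **NO LOOP, NO PARALLEL PAIR ⟹ SIMPLE**: `ρ{x, y} = 2` for all `x ≠ y` in `E`. -/
theorem rk_pair_of_no_loop_no_parallel (hloop : ¬ ∃ x ∈ gr N, rk N {x} = 0)
    (hpar : ¬ ∃ x ∈ gr N, ∃ x' ∈ gr N, x ≠ x' ∧ rk N {x} = 1 ∧ rk N {x'} = 1 ∧ x' ∈ clF N {x}) {x y : α}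
    (hx : x ∈ gr N) (hy : y ∈ gr N) (hxy : x ≠ y) : rk N {x, y} = 2 := by
  have hrx : rk N {x} = 1 := by
    have h1 := rk_le_card (M := N) {x}
    rw [card_singleton] at h1
    have h2 : rk N {x} ≠ 0 := fun h => hloop ⟨x, hx, h⟩
    omega
  have hry : rk N {y} = 1 := by
    have h1 := rk_le_card (M := N) {y}
    rw [card_singleton] at h1
    have h2 : rk N {y} ≠ 0 := fun h => hloop ⟨y, hy, h⟩
    omega
  have h := rk_insert_eq hy (singleton_subset_iff.2 hx) (M := N)
  rw [pair_comm] at h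
  split_ifs at h with hcl
  · exact absurd ⟨x, hx, y, hy, hxy, hrx, hry, hcl⟩ hpar
  · rw [h, hrx]

/-- **COLOOP-FREE, NO SERIES PAIR ⟹ COSIMPLE**: `ρ(E − x − y) = ρ(E)` for all `x ≠ y` in `E`. -/
theorem rk_erase_erase_of_no_seriesPair (hcf : ∀ x ∈ gr N, rk N ((gr N).erase x) = rk N (gr N))
    (hser : ¬ ∃ b b' : α, SeriesPair N b b') {x y : α} (hx : x ∈ gr N) (hy : y ∈ gr N) (hxy : x ≠ y) :
    rk N (((gr N).erase x).erase y) = rk N (gr N) := by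
  have hyx : y ∈ (gr N).erase x := mem_erase.2 ⟨hxy.symm, hy⟩
  have h1 := rk_insert_eq hy ((erase_subset _ _).trans (erase_subset _ _) : ((gr N).erase x).erase y ⊆ gr N)
    (M := N)
  rw [insert_erase hyx, hcf x hx] at h1
  split_ifs at h1 with hcl
  · exact h1.symm
  · exfalso
    exact hser ⟨x, y, hx, hy, hxy, hcf x hx, hcf y hy, by omega⟩

/-- **`StarNine` FROM THE DEFECT BOUND ON THE CORE**: (★)₉ on every coloop-free nine-point rank-5 matroid follows from
`|D_e| ≤ |D_f| + |C|` on the simple cosimple ones. -/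
theorem starNine_of_coreDefectBound
    (hcore : ∀ (M : Matroid α) [M.Finite], (gr M).card = 9 → rk M (gr M) = 5 →
      (∀ x ∈ gr M, rk M ((gr M).erase x) = 5) → (∀ x ∈ gr M, ∀ y ∈ gr M, x ≠ y → rk M {x, y} = 2) →
      (∀ x ∈ gr M, ∀ y ∈ gr M, x ≠ y → rk M (((gr M).erase x).erase y) = 5) →
      ∀ e ∈ gr M, ∀ f ∈ gr M, e ≠ f →
        (defTriples M e f e \ defTriples M e f f).card ≤
          (defTriples M e f f \ defTriples M e f e).card + (cPairs M e f).card) :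
    StarNine α := by
  intro M _ hn hR hcf e he f hf hef
  by_cases hstr : (∃ x ∈ gr M, rk M {x} = 0) ∨
      (∃ x ∈ gr M, ∃ x' ∈ gr M, x ≠ x' ∧ rk M {x} = 1 ∧ rk M {x'} = 1 ∧ x' ∈ clF M {x}) ∨
      (∃ b b' : α, SeriesPair M b b')
  · exact starNine_of_not_simple_cosimple hn hR hcf hstr he hf hef
  · rw [not_or, not_or] at hstr
    obtain ⟨hloop, hpar, hser⟩ := hstr
    have hsimple : ∀ x ∈ gr M, ∀ y ∈ gr M, x ≠ y → rk M {x, y} = 2 :=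
      fun x hx y hy hxy => rk_pair_of_no_loop_no_parallel hloop hpar hx hy hxy
    have hcos : ∀ x ∈ gr M, ∀ y ∈ gr M, x ≠ y → rk M (((gr M).erase x).erase y) = 5 := by
      intro x hx y hy hxy
      rw [rk_erase_erase_of_no_seriesPair (fun z hz => by rw [hcf z hz, hR]) hser hx hy hxy, hR]
    exact starNine_of_defect_bound hef (hcore M hn hR hcf hsimple hcos e he f hf hef)

end StarNineDefectD

end PercRepro.Cogirth
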